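import Literature.MathematicalPhysics.QuantumFieldTheory.YangMillsOS
import Literature.MathematicalPhysics.QuantumFieldTheory.SpeciesLatticeProducts
import Literature.MathematicalPhysics.QuantumFieldTheory.OSLorentzInvariance
import Literature.MathematicalPhysics.QuantumFieldTheory.LatticeGaugeProofs
import Summits.QuantumFields.YangMills.Theorems.LangevinControlUVOSLegsFromFemtoAndGapStubUpgradeGivens
import HarnessLib

/-!
# Angle calculus for the rotated Wilson lattice correlator (stub `stub_angleCalculus`)

Support file for the line `WardDefectSketch` of crux `CurvatureAmnesia` (item stmt-QuantumFields-16192,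
routes `ScalingWindowSplit` / `CoincidenceRotationBootstrap`): the registered stub `stub_angleCalculus`,
proved verbatim.  Pure proof file: no definitions, no notation.

**Statement.**  Rotate every member of a real family `f : Fin n → 𝓢(ℝ⁴, ℝ)` in the `(x₀,x₁)`-plane,
`fⱼ^t := linActTest (planeRot 0 t) fⱼ = fⱼ ∘ (planeRot 0 t)⁻¹`, and read the renormalised joint Wilson lattice
`n`-point function of the all-curvature string, `t ↦ latticeSchwinger r.ρ sch (·.F) k n (fun _ ↦ r.curvature) f^t`.
This is differentiable in the angle, with derivative at `θ` equal to MINUS the one-insertion lattice Ward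
functional `Σᵢ ⟨Φ(f₁^θ) ⋯ Φ((L fᵢ)^θ) ⋯ Φ(f_n^θ)⟩`, `L = x₁ ∂₀ − x₀ ∂₁`.

**Proof.**
* `hasDerivAt_rho_symm`: `t ↦ (planeRot 0 t)⁻¹ y = planeRot 0 (−t) y` is
  `y + (cos t − 1)(y₀e₀ + y₁e₁) + sin t (−y₁e₀ + y₀e₁)`, with velocity `−z₁ e₀ + z₀ e₁` at `z = (planeRot 0 θ)⁻¹ y`;
* `hasDerivAt_comp_rho_symm`: chain rule with the Fréchet derivative of the Schwartz function,
  `d/dt g((planeRot 0 t)⁻¹ y) = −(L g)((planeRot 0 θ)⁻¹ y)`;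
* `hasDerivAt_smearedLatticeField_rot`, `hasDerivAt_obsProd_rot`: the smeared lattice field is a finite linear
  combination of samples of the test function, the integrand of `latticeSchwinger` a finite product (Leibniz rule,
  written with `Function.update`);
* `stub_angleCalculus`: differentiation under the integral sign (`hasDerivAt_integral_of_dominated_loc_of_deriv_le`)
  against the probability measure `wilsonMeasure` (`isProbabilityMeasure_wilsonMeasure`), the integrand and its
  angular derivative being measurable and bounded uniformly in the configuration and in the angle (observables are
  bounded, Schwartz functions are bounded by their `(0,0)` seminorm, which is rotation invariant).

References: folklore (Leibniz rule, differentiation of parameter integrals, H. Amann, J. Escher, Analysis III, X.3.18).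
-/

noncomputable section

namespace Summit.QuantumFields.YangMills.Cruxes.CurvatureAmnesia.WardDefect

open scoped SchwartzMap BigOperators
open MeasureTheory Filter Literature.MathematicalPhysics.QuantumLattice Literature.MathematicalPhysics.AQFT
  Literature.MathematicalPhysics.QuantumFieldTheory
open Summit.QuantumFields.YangMills.Theorems.OSLegsFromFemtoAndGap.Upgrade (rho_symm_apply)
open Literature.Probability.LatticeModels (box)

/-! ### The angular derivative of a rotated test function -/

/-- The inverse plane rotation as an affine expression in `cos t`, `sin t`:
`(planeRot 0 t)⁻¹ y = y + (cos t − 1)(y₀ e₀ + y₁ e₁) + sin t (−y₁ e₀ + y₀ e₁)`. [folklore] -/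
theorem rho_symm_eq_cos_sin (y : EuclideanSpace ℝ (Fin 4)) (t : ℝ) :
    (planeRot (d := 3) 0 t).symm y =
      y + (Real.cos t - 1) • ((y 0) • EuclideanSpace.single (0 : Fin 4) (1 : ℝ) +
          (y 1) • EuclideanSpace.single (1 : Fin 4) (1 : ℝ)) +
        Real.sin t • (-((y 1) • EuclideanSpace.single (0 : Fin 4) (1 : ℝ)) +
          (y 0) • EuclideanSpace.single (1 : Fin 4) (1 : ℝ)) := by
  rw [rho_symm_apply]
  ext j
  fin_cases j <;> simp <;> ring

/-- **Angular velocity of the inverse plane rotation**: `t ↦ (planeRot 0 t)⁻¹ y` has derivative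
`−z₁ e₀ + z₀ e₁` at `t = θ`, where `z = (planeRot 0 θ)⁻¹ y`. [folklore] -/
theorem hasDerivAt_rho_symm (y : EuclideanSpace ℝ (Fin 4)) (θ : ℝ) :
    HasDerivAt (fun t : ℝ => (planeRot (d := 3) 0 t).symm y)
      (-((planeRot (d := 3) 0 θ).symm y 1) • EuclideanSpace.single (0 : Fin 4) (1 : ℝ) +
        ((planeRot (d := 3) 0 θ).symm y 0) • EuclideanSpace.single (1 : Fin 4) (1 : ℝ)) θ := by
  have h : HasDerivAt (fun t : ℝ =>
      y + (Real.cos t - 1) • ((y 0) • EuclideanSpace.single (0 : Fin 4) (1 : ℝ) +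
          (y 1) • EuclideanSpace.single (1 : Fin 4) (1 : ℝ)) +
        Real.sin t • (-((y 1) • EuclideanSpace.single (0 : Fin 4) (1 : ℝ)) +
          (y 0) • EuclideanSpace.single (1 : Fin 4) (1 : ℝ)))
      (-Real.sin θ • ((y 0) • EuclideanSpace.single (0 : Fin 4) (1 : ℝ) +
          (y 1) • EuclideanSpace.single (1 : Fin 4) (1 : ℝ)) +
        Real.cos θ • (-((y 1) • EuclideanSpace.single (0 : Fin 4) (1 : ℝ)) +
          (y 0) • EuclideanSpace.single (1 : Fin 4) (1 : ℝ))) θ :=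
    ((((Real.hasDerivAt_cos θ).sub_const 1).smul_const _).const_add y).add
      ((Real.hasDerivAt_sin θ).smul_const _)
  rw [show (fun t : ℝ => (planeRot (d := 3) 0 t).symm y) = _ from funext fun t => rho_symm_eq_cos_sin y t]
  refine h.congr_deriv ?_
  rw [rho_symm_eq_cos_sin y θ]
  ext j
  fin_cases j <;> simp <;> ring

/-- **Angular derivative of a rotated Schwartz function**: for `g ∈ 𝓢(ℝ⁴)` and `y ∈ ℝ⁴`,
`d/dt g((planeRot 0 t)⁻¹ y) |_{t=θ} = −(L g)((planeRot 0 θ)⁻¹ y)` with the rotation generator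
`L g = x₁ ∂₀ g − x₀ ∂₁ g` (chain rule). [folklore] -/
theorem hasDerivAt_comp_rho_symm (g : 𝓢(EuclideanSpace ℝ (Fin 4), ℝ)) (y : EuclideanSpace ℝ (Fin 4))
    (θ : ℝ) :
    HasDerivAt (fun t : ℝ => g ((planeRot (d := 3) 0 t).symm y))
      (-((SchwartzMap.smulLeftCLM ℝ (fun x : EuclideanSpace ℝ (Fin 4) => x 1)
            (LineDeriv.lineDerivOp (EuclideanSpace.single (0 : Fin 4) (1 : ℝ) : EuclideanSpace ℝ (Fin 4)) g) -
          SchwartzMap.smulLeftCLM ℝ (fun x : EuclideanSpace ℝ (Fin 4) => x 0)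
            (LineDeriv.lineDerivOp (EuclideanSpace.single (1 : Fin 4) (1 : ℝ) : EuclideanSpace ℝ (Fin 4)) g))
        ((planeRot (d := 3) 0 θ).symm y))) θ := by
  have h0 : Function.HasTemperateGrowth (fun x : EuclideanSpace ℝ (Fin 4) => x 0) :=
    (EuclideanSpace.proj (0 : Fin 4) : EuclideanSpace ℝ (Fin 4) →L[ℝ] ℝ).hasTemperateGrowth
  have h1 : Function.HasTemperateGrowth (fun x : EuclideanSpace ℝ (Fin 4) => x 1) :=
    (EuclideanSpace.proj (1 : Fin 4) : EuclideanSpace ℝ (Fin 4) →L[ℝ] ℝ).hasTemperateGrowth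
  have h := (g.hasFDerivAt ((planeRot (d := 3) 0 θ).symm y)).comp_hasDerivAt θ (hasDerivAt_rho_symm y θ)
  refine h.congr_deriv ?_
  simp only [map_add, map_smul, smul_eq_mul, sub_apply,
    SchwartzMap.smulLeftCLM_apply_apply h0, SchwartzMap.smulLeftCLM_apply_apply h1,
    SchwartzMap.lineDerivOp_apply_eq_fderiv]
  ring

/-! ### Smeared lattice fields and their products along the rotated family -/

section Lattice

variable {G : Type} [MeasurableSpace G]

/-- **Angular derivative of a smeared lattice field**: at fixed configuration `V`,
`d/dt Φ(g^t)(V) |_{t=θ} = −Φ((L g)^θ)(V)` — the smeared field `c a⁴ Σₓ g^t(a x)(O(τₓV) − m)` is a finite linear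
combination of samples of the rotated test function. [folklore] -/
theorem hasDerivAt_smearedLatticeField_rot (O : LGConfig 4 G → ℝ)
    (Λ : Finset (Literature.Probability.LatticeModels.Site 4)) (a c m : ℝ)
    (g : 𝓢(EuclideanSpace ℝ (Fin 4), ℝ)) (V : LGConfig 4 G) (θ : ℝ) :
    HasDerivAt (fun t : ℝ => smearedLatticeField O Λ a c m (linActTest (planeRot (d := 3) 0 t) g) V)
      (-(smearedLatticeField O Λ a c m (linActTest (planeRot (d := 3) 0 θ)
        (SchwartzMap.smulLeftCLM ℝ (fun x : EuclideanSpace ℝ (Fin 4) => x 1)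
            (LineDeriv.lineDerivOp (EuclideanSpace.single (0 : Fin 4) (1 : ℝ) : EuclideanSpace ℝ (Fin 4)) g) -
          SchwartzMap.smulLeftCLM ℝ (fun x : EuclideanSpace ℝ (Fin 4) => x 0)
            (LineDeriv.lineDerivOp (EuclideanSpace.single (1 : Fin 4) (1 : ℝ) : EuclideanSpace ℝ (Fin 4)) g)))
        V)) θ := by
  simp only [smearedLatticeField, linActTest_apply]
  have h := HasDerivAt.const_mul (c * a ^ 4) (HasDerivAt.fun_sum fun x (_ : x ∈ Λ) =>
    (hasDerivAt_comp_rho_symm g (a • siteToE x) θ).mul_const (O (configShift (-x) V) - m))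
  refine h.congr_deriv ?_
  rw [← mul_neg, ← Finset.sum_neg_distrib]
  refine congrArg _ (Finset.sum_congr rfl fun x _ => ?_)
  rw [neg_mul]

/-- **Uniform bound.** A smeared lattice field of a bounded observable against a rotated/reflected Schwartz
function is bounded uniformly in the configuration AND in the linear isometry (Schwartz functions are bounded by
their rotation-invariant `(0,0)` seminorm). [folklore] -/
theorem exists_bound_smearedLatticeField_linActTest {O : LGConfig 4 G → ℝ} (hO : ∃ C, ∀ U, |O U| ≤ C)
    (Λ : Finset (Literature.Probability.LatticeModels.Site 4)) (a c m : ℝ)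
    (g : 𝓢(EuclideanSpace ℝ (Fin 4), ℝ)) :
    ∃ B, ∀ (R : EuclideanSpace ℝ (Fin 4) ≃ₗᵢ[ℝ] EuclideanSpace ℝ (Fin 4)) (V : LGConfig 4 G),
      |smearedLatticeField O Λ a c m (linActTest R g) V| ≤ B := by
  obtain ⟨C, hC⟩ := hO
  refine ⟨|c * a ^ 4| * ∑ _x ∈ Λ, SchwartzMap.seminorm ℝ 0 0 g * (C + |m|), fun R V => ?_⟩
  unfold smearedLatticeField
  rw [abs_mul]
  refine mul_le_mul_of_nonneg_left ((Finset.abs_sum_le_sum_abs _ _).trans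
    (Finset.sum_le_sum fun x _ => ?_)) (abs_nonneg _)
  rw [abs_mul]
  refine mul_le_mul ?_ ((abs_sub _ _).trans (add_le_add (hC _) le_rfl)) (abs_nonneg _)
    (apply_nonneg _ _)
  rw [linActTest_apply, ← Real.norm_eq_abs]
  exact SchwartzMap.norm_le_seminorm ℝ g _

/-- A product with one factor updated: `∏ⱼ Φⱼ((update F i g)ⱼ) = Φᵢ(g) · ∏_{j ≠ i} Φⱼ(Fⱼ)`. [folklore] -/
theorem prod_apply_update_eq {ι α β : Type*} [Fintype ι] [DecidableEq ι] [CommMonoid β]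
    (Φ : ι → α → β) (F : ι → α) (i : ι) (g : α) :
    ∏ j, Φ j (Function.update F i g j) = Φ i g * ∏ j ∈ Finset.univ.erase i, Φ j (F j) := by
  rw [← Finset.mul_prod_erase _ _ (Finset.mem_univ i), Function.update_self]
  congr 1
  exact Finset.prod_congr rfl fun j hj => by rw [Function.update_of_ne (Finset.ne_of_mem_erase hj)]

variable [Group G]

/-- **Leibniz rule for the integrand of `latticeSchwinger` along the rotated family**: at fixed torus
configuration `U`, `d/dt ∏ⱼ Φⱼ(fⱼ^t)(Ũ) |_{t=θ} = −Σᵢ ∏ⱼ Φⱼ((update f^θ i (L fᵢ)^θ)ⱼ)(Ũ)`. [folklore] -/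
theorem hasDerivAt_obsProd_rot (sch : SpeciesScheme (YMSpecies G)) (k : ℕ) {n : ℕ}
    (σ : Fin n → YMSpecies G) (f : Fin n → 𝓢(EuclideanSpace ℝ (Fin 4), ℝ))
    (U : GaugeConfig 4 (sch.side k) G) (θ : ℝ) :
    HasDerivAt (fun t : ℝ => obsProd sch k σ (fun j => linActTest (planeRot (d := 3) 0 t) (f j)) U)
      (-(∑ i : Fin n, obsProd sch k σ
        (Function.update (fun j => linActTest (planeRot (d := 3) 0 θ) (f j)) i
          (linActTest (planeRot (d := 3) 0 θ)
            (SchwartzMap.smulLeftCLM ℝ (fun x : EuclideanSpace ℝ (Fin 4) => x 1)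
                (LineDeriv.lineDerivOp (EuclideanSpace.single (0 : Fin 4) (1 : ℝ) : EuclideanSpace ℝ (Fin 4))
                  (f i)) -
              SchwartzMap.smulLeftCLM ℝ (fun x : EuclideanSpace ℝ (Fin 4) => x 0)
                (LineDeriv.lineDerivOp (EuclideanSpace.single (1 : Fin 4) (1 : ℝ) : EuclideanSpace ℝ (Fin 4))
                  (f i))))) U)) θ := by
  unfold obsProd
  have h := HasDerivAt.fun_finsetProd (u := Finset.univ) fun j (_ : j ∈ (Finset.univ : Finset (Fin n))) =>
    hasDerivAt_smearedLatticeField_rot (σ j).F (box 4 (sch.L k)) (sch.a k) (sch.c (σ j) k) (sch.m (σ j) k)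
      (f j) (torusLift (sch.side k) U) θ
  refine h.congr_deriv ?_
  rw [← Finset.sum_neg_distrib]
  refine Finset.sum_congr rfl fun i _ => ?_
  rw [smul_eq_mul, mul_neg, neg_inj, mul_comm]
  exact (prod_apply_update_eq (fun j φ => smearedLatticeField (σ j).F (box 4 (sch.L k)) (sch.a k)
    (sch.c (σ j) k) (sch.m (σ j) k) φ (torusLift (sch.side k) U)) _ i _).symm

/-- **Uniform bound for the one-insertion sum**: `|Σᵢ ∏ⱼ Φⱼ((update (R·f) i (R·gᵢ))ⱼ)(Ũ)|` is bounded uniformly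
in the linear isometry `R` and the configuration `U`. [folklore] -/
theorem exists_bound_sum_obsProd_update (sch : SpeciesScheme (YMSpecies G)) (k : ℕ) {n : ℕ}
    (σ : Fin n → YMSpecies G) (f g : Fin n → 𝓢(EuclideanSpace ℝ (Fin 4), ℝ)) :
    ∃ B, ∀ (R : EuclideanSpace ℝ (Fin 4) ≃ₗᵢ[ℝ] EuclideanSpace ℝ (Fin 4)) (U : GaugeConfig 4 (sch.side k) G),
      |∑ i : Fin n, obsProd sch k σ
        (Function.update (fun j => linActTest R (f j)) i (linActTest R (g i))) U| ≤ B := by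
  choose B hB using fun j => exists_bound_smearedLatticeField_linActTest (σ j).bounded (box 4 (sch.L k))
    (sch.a k) (sch.c (σ j) k) (sch.m (σ j) k) (f j)
  choose B' hB' using fun j => exists_bound_smearedLatticeField_linActTest (σ j).bounded (box 4 (sch.L k))
    (sch.a k) (sch.c (σ j) k) (sch.m (σ j) k) (g j)
  refine ⟨∑ _i : Fin n, ∏ j, max (B j) (B' j), fun R U =>
    (Finset.abs_sum_le_sum_abs _ _).trans (Finset.sum_le_sum fun i _ => ?_)⟩
  rw [obsProd, Finset.abs_prod]
  refine Finset.prod_le_prod (fun j _ => abs_nonneg _) fun j _ => ?_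
  by_cases hj : j = i
  · subst hj
    rw [Function.update_self]
    exact (hB' j R _).trans (le_max_right _ _)
  · rw [Function.update_of_ne hj]
    exact (hB j R _).trans (le_max_left _ _)

/-- **Uniform bound for the integrand**: `|∏ⱼ Φⱼ((R·f)ⱼ)(Ũ)|` is bounded uniformly in `R` and `U`. [folklore] -/
theorem exists_bound_obsProd_linActTest (sch : SpeciesScheme (YMSpecies G)) (k : ℕ) {n : ℕ}
    (σ : Fin n → YMSpecies G) (f : Fin n → 𝓢(EuclideanSpace ℝ (Fin 4), ℝ)) :
    ∃ B, ∀ (R : EuclideanSpace ℝ (Fin 4) ≃ₗᵢ[ℝ] EuclideanSpace ℝ (Fin 4)) (U : GaugeConfig 4 (sch.side k) G),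
      |obsProd sch k σ (fun j => linActTest R (f j)) U| ≤ B := by
  choose B hB using fun j => exists_bound_smearedLatticeField_linActTest (σ j).bounded (box 4 (sch.L k))
    (sch.a k) (sch.c (σ j) k) (sch.m (σ j) k) (f j)
  refine ⟨∏ j, B j, fun R U => ?_⟩
  rw [obsProd, Finset.abs_prod]
  exact Finset.prod_le_prod (fun j _ => abs_nonneg _) fun j _ => hB j R _

end Lattice

/-! ### The registered stub -/

/-- (C) differentiability of the rotated correlator in the angle, derivative `−W_k` — expanded form of
`AngleCalculus`. -/
theorem stub_angleCalculus :
    ∀ (G : Type) [Group G] [TopologicalSpace G] [IsTopologicalGroup G] [CompactSpace G] [MeasurableSpace G]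
      [BorelSpace G] (r : LatticeRep G) (sch : SpeciesScheme (YMSpecies G)) (k n : ℕ)
      (f : Fin n → 𝓢(EuclideanSpace ℝ (Fin 4), ℝ)) (θ : ℝ),
      HasDerivAt
        (fun t : ℝ => latticeSchwinger r.ρ sch (fun s => s.F) k n (fun _ => r.curvature)
          (fun j => linActTest (planeRot (d := 3) 0 t) (f j)))
        (-(∑ i : Fin n, latticeSchwinger r.ρ sch (fun s => s.F) k n (fun _ => r.curvature)
          (Function.update (fun j => linActTest (planeRot (d := 3) 0 θ) (f j)) i
            (linActTest (planeRot (d := 3) 0 θ)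
              (SchwartzMap.smulLeftCLM ℝ (fun x : EuclideanSpace ℝ (Fin 4) => x 1)
                  (LineDeriv.lineDerivOp (EuclideanSpace.single (0 : Fin 4) (1 : ℝ) : EuclideanSpace ℝ (Fin 4))
                    (f i)) -
                SchwartzMap.smulLeftCLM ℝ (fun x : EuclideanSpace ℝ (Fin 4) => x 0)
                  (LineDeriv.lineDerivOp (EuclideanSpace.single (1 : Fin 4) (1 : ℝ) : EuclideanSpace ℝ (Fin 4))
                    (f i)))))))
        θ := by
  intro G _ _ _ _ _ _ r sch k n f θ
  haveI := isProbabilityMeasure_wilsonMeasure (d := 4) (L := sch.side k) r.ρ r.continuous (sch.β k)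
  -- the generator family `L f`
  set Lf : Fin n → 𝓢(EuclideanSpace ℝ (Fin 4), ℝ) := fun i =>
    SchwartzMap.smulLeftCLM ℝ (fun x : EuclideanSpace ℝ (Fin 4) => x 1)
        (LineDeriv.lineDerivOp (EuclideanSpace.single (0 : Fin 4) (1 : ℝ) : EuclideanSpace ℝ (Fin 4)) (f i)) -
      SchwartzMap.smulLeftCLM ℝ (fun x : EuclideanSpace ℝ (Fin 4) => x 0)
        (LineDeriv.lineDerivOp (EuclideanSpace.single (1 : Fin 4) (1 : ℝ) : EuclideanSpace ℝ (Fin 4)) (f i))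
    with hLf
  set μ : Measure (GaugeConfig 4 (sch.side k) G) := wilsonMeasure (d := 4) (L := sch.side k) r.ρ (sch.β k)
    with hμ
  -- integrand and its angular derivative
  set F : ℝ → GaugeConfig 4 (sch.side k) G → ℝ := fun t U =>
    obsProd sch k (fun _ => r.curvature) (fun j => linActTest (planeRot (d := 3) 0 t) (f j)) U with hF
  set F' : ℝ → GaugeConfig 4 (sch.side k) G → ℝ := fun t U =>
    -(∑ i : Fin n, obsProd sch k (fun _ => r.curvature)
      (Function.update (fun j => linActTest (planeRot (d := 3) 0 t) (f j)) i
        (linActTest (planeRot (d := 3) 0 t) (Lf i))) U) with hF'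
  have hF_meas : ∀ t, AEStronglyMeasurable (F t) μ := fun t =>
    (measurable_obsProd sch k _ _).aestronglyMeasurable
  obtain ⟨B, hB⟩ := exists_bound_obsProd_linActTest sch k (fun _ => r.curvature) f
  have hF_int : Integrable (F θ) μ :=
    Integrable.of_bound (hF_meas θ) B (Eventually.of_forall fun U => hB _ U)
  have hupd_meas : ∀ (t : ℝ) (i : Fin n), Measurable fun U => obsProd sch k (fun _ => r.curvature)
      (Function.update (fun j => linActTest (planeRot (d := 3) 0 t) (f j)) i
        (linActTest (planeRot (d := 3) 0 t) (Lf i))) U := fun t i =>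
    measurable_obsProd sch k _ _
  have hF'_meas : AEStronglyMeasurable (F' θ) μ :=
    (Finset.measurable_sum _ fun i _ => hupd_meas θ i).neg.aestronglyMeasurable
  obtain ⟨B', hB'⟩ := exists_bound_sum_obsProd_update sch k (fun _ => r.curvature) f Lf
  have h_bound : ∀ᵐ U ∂μ, ∀ t ∈ (Set.univ : Set ℝ), ‖F' t U‖ ≤ B' :=
    Eventually.of_forall fun U t _ => by
      rw [hF', Real.norm_eq_abs, abs_neg]
      exact hB' _ U
  have h_diff : ∀ᵐ U ∂μ, ∀ t ∈ (Set.univ : Set ℝ), HasDerivAt (F · U) (F' t U) t :=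
    Eventually.of_forall fun U t _ => hasDerivAt_obsProd_rot sch k (fun _ => r.curvature) f U t
  have key := (hasDerivAt_integral_of_dominated_loc_of_deriv_le (μ := μ) (x₀ := θ) (bound := fun _ => B')
    univ_mem (Eventually.of_forall hF_meas) hF_int hF'_meas h_bound (integrable_const B') h_diff).2
  have hint : ∀ i : Fin n, Integrable (fun U => obsProd sch k (fun _ => r.curvature)
      (Function.update (fun j => linActTest (planeRot (d := 3) 0 θ) (f j)) i
        (linActTest (planeRot (d := 3) 0 θ) (Lf i))) U) μ := fun i => by
    obtain ⟨Bi, hBi⟩ := exists_bound_obsProd sch k (fun _ => r.curvature)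
      (Function.update (fun j => linActTest (planeRot (d := 3) 0 θ) (f j)) i
        (linActTest (planeRot (d := 3) 0 θ) (Lf i)))
    exact Integrable.of_bound (hupd_meas θ i).aestronglyMeasurable Bi (Eventually.of_forall hBi)
  have key2 : HasDerivAt (fun t => ∫ U, F t U ∂μ)
      (-(∑ i : Fin n, ∫ U, obsProd sch k (fun _ => r.curvature)
        (Function.update (fun j => linActTest (planeRot (d := 3) 0 θ) (f j)) i
          (linActTest (planeRot (d := 3) 0 θ) (Lf i))) U ∂μ)) θ := by
    refine key.congr_deriv ?_
    rw [hF', integral_neg, integral_finsetSum _ fun i _ => hint i]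
  exact key2

end Summit.QuantumFields.YangMills.Cruxes.CurvatureAmnesia.WardDefect

end
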